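import Summits.BirchSwinnertonDyer.BirchSwinnertonDyer.Theorems.ResidualThetaTransportAtTwoResidualSignedLambdaLowerCMAtTwoDualityGlue
import Summits.BirchSwinnertonDyer.BirchSwinnertonDyer.Theorems.ResidualThetaTransportAtTwoLambdaLowerBoundOWeierstrass
import HarnessLib

/-!
# The MEMBERSHIP socket for `hm` (STUB-PLAN rev 7 Q23 / helper (ζ)): `c•M ⊆ N` with `c` invertible in `K` ⇒ `λ(P/N) ≤ λ(P/M)`,
# constants wash out of quotients, saturation transfer of the flank — and the M3-fed corollaries of the one-sided assembly

Route `ResidualThetaTransportAtTwo` (RTT), crux RSL_g `ResidualSignedLambdaLowerCMAtTwo` (stmt-BirchSwinnertonDyer-22608; the (R≥)ᵖ crux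
stmt-BirchSwinnertonDyer-26074 is glue above it). Seat `prover-bsd-wall-rtt-p2` g16 (`--supports`, closes nothing). Adapted from the crux sketch
`Cruxes/ResidualThetaCountLowerPureAtTwo/Sketch_sidea_k1_g5.lean` §1–§2 (stub-ideation k1 g5, M0–M5; kernel-checked there, not importable);
M0 / P4 are NOT re-landed (`CharIdealLambda.subsingleton_baseChange_of_pow_smul_eq_zero`, `…FourTermDuality`), M2 is routed through the tree's
`LambdaLowerBoundO.finrank_baseChange_eq_of_surjective_of_smul_ker_eq_zero`. THEOREMS ONLY (no definition, no named fact, no instance, no `sorry`);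
pure module algebra; BSD is not proved by any of this; 22608 / 26074 OPEN.

WHY (STUB-PLAN rev 7 §3.1′(b), §3.2′). The HOLD KZ_g is to be filed with clause (i) in MEMBERSHIP form «`(C c)·𝒸 z ∈ (D·ι Lm)`» (weaker than
an equality, insensitive to units / signs / normalisation). The consumer's `hm : d + e ≤ λ(Λ/(𝒸 z))` then follows from M3 below with
`M := (𝒸 z)`, `N := (D·ι Lm)`: `λ(Λ/(D·ι Lm)) ≤ λ(Λ/(𝒸 z))`, and `λ(Λ/(D·ι Lm)) = d + λ(Λ/(D))` (`finrank_baseChange_quotient_span_mul_eq_add`).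

* §1 `finrank_baseChange_quotient_anti` (M1: `N' ≤ N ⇒ λ(P/N) ≤ λ(P/N')`), `finrank_baseChange_quotient_eq_of_smul_le` /
  `finite_baseChange_quotient_of_smul_le` (M2: `N' ≤ N`, `c•N ⊆ N'` ⇒ `λ(P/N') = λ(P/N)`), **`finrank_baseChange_quotient_le_of_smul_mem`**
  (M3: `c•M ⊆ N ⇒ λ(P/N) ≤ λ(P/M)`), `finrank_baseChange_quotient_eq_of_saturation` (M4), `finrank_baseChange_quotient_span_le_of_C_smul_mem`
  (M3 for principal ideals of `Λ = A⟦X⟧`: `(C c)·w ∈ (F) ⇒ λ(Λ/(F)) ≤ λ(Λ/(w))`).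
* §2 **`le_finrank_baseChange_of_fourTerm_oneSided_of_smul_mem`**, **`le_finrank_baseChange_characterModule_of_duality_of_smul_mem`** — the
  one-sided four-term assembly (p663510) and the N5 duality bound (p664041) with `hm` fed by a membership clause through M3.

References: [Kato2004Asterisque] Thm. 12.5 (1) (membership form of the reciprocity law); [Washington1997] §13.2; [Kobayashi2003] Thm. 7.3.
-/

set_option autoImplicit false
-- the Theorems namespace of this sub repeats the summit name by design (D-0017 nested layout)
set_option linter.dupNamespace false

noncomputable section

open scoped TensorProduct Classical

namespace Summit.BirchSwinnertonDyer.BirchSwinnertonDyer.Theorems.CharIdealLambda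

open Function

universe u v w

/-! ## §1 The membership kernel (M1–M4) -/

section MembershipKernel

-- adapted from Cruxes/ResidualThetaCountLowerPureAtTwo/Sketch_sidea_k1_g5.lean §1 (stub-ideation k1 g5), M1–M4

variable {A : Type u} [CommRing A] (K : Type w) [Field K] [Algebra A K]
variable {P : Type v} [AddCommGroup P] [Module A P] {N N' : Submodule A P}

/-- **M1 (antitone).** `N' ≤ N ⇒ λ(P ⧸ N) ≤ λ(P ⧸ N')` (the factor map is onto; right exactness of `K ⊗_A ·`). [folklore] -/
theorem finrank_baseChange_quotient_anti (h : N' ≤ N) [Module.Finite K (K ⊗[A] (P ⧸ N'))] :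
    Module.finrank K (K ⊗[A] (P ⧸ N)) ≤ Module.finrank K (K ⊗[A] (P ⧸ N')) := by
  have hs : Surjective ((Submodule.factor h).baseChange K) := by
    rw [LinearMap.baseChange_eq_ltensor]
    exact LinearMap.lTensor_surjective K (Submodule.factor_surjective h)
  calc Module.finrank K (K ⊗[A] (P ⧸ N))
      = Module.finrank K (LinearMap.range ((Submodule.factor h).baseChange K)) := by
        rw [LinearMap.range_eq_top.mpr hs, finrank_top]
    _ ≤ Module.finrank K (K ⊗[A] (P ⧸ N')) := LinearMap.finrank_range_le _

/-- The kernel of the factor map `P ⧸ N' → P ⧸ N` is killed by `c` when `c•N ⊆ N'`. [folklore] -/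
theorem smul_eq_zero_of_mem_ker_factor (h₁ : N' ≤ N) (c : A) (h₂ : ∀ n ∈ N, c • n ∈ N')
    (x : P ⧸ N') (hx : x ∈ LinearMap.ker (Submodule.factor h₁)) : c • x = 0 := by
  induction x using Submodule.Quotient.induction_on with
  | H p =>
    rw [LinearMap.mem_ker, ← Submodule.mkQ_apply, Submodule.factor_mk, Submodule.mkQ_apply, Submodule.Quotient.mk_eq_zero] at hx
    rw [← Submodule.Quotient.mk_smul, Submodule.Quotient.mk_eq_zero]
    exact h₂ p hx

/-- **M2 (constants wash out).** `N' ≤ N`, `c•N ⊆ N'`, `c` a unit in `K` ⇒ `λ(P ⧸ N') = λ(P ⧸ N)` (the kernel `N/N'` of the factor map is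
`c`-torsion; `LambdaLowerBoundO.finrank_baseChange_eq_of_surjective_of_smul_ker_eq_zero`). [folklore] -/
theorem finrank_baseChange_quotient_eq_of_smul_le (c : A) (hc : IsUnit (algebraMap A K c)) (h₁ : N' ≤ N)
    (h₂ : ∀ n ∈ N, c • n ∈ N') :
    Module.finrank K (K ⊗[A] (P ⧸ N')) = Module.finrank K (K ⊗[A] (P ⧸ N)) :=
  LambdaLowerBoundO.finrank_baseChange_eq_of_surjective_of_smul_ker_eq_zero K (Submodule.factor h₁)
    (Submodule.factor_surjective h₁) c hc (smul_eq_zero_of_mem_ker_factor h₁ c h₂)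

/-- M2, finiteness: under the same hypotheses `K ⊗ (P ⧸ N')` is finite-dimensional when `K ⊗ (P ⧸ N)` is (`K ⊗ (P/N') ≅ K ⊗ (P/N)`).
[folklore] -/
theorem finite_baseChange_quotient_of_smul_le (c : A) (hc : IsUnit (algebraMap A K c)) (h₁ : N' ≤ N)
    (h₂ : ∀ n ∈ N, c • n ∈ N') [Module.Finite K (K ⊗[A] (P ⧸ N))] :
    Module.Finite K (K ⊗[A] (P ⧸ N')) := by
  -- `K ⊗ (factor h₁)` is bijective: surjective by right exactness, injective since its kernel `K ⊗ (N/N')` vanishes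
  have hexact := lTensor_exact K (LinearMap.exact_subtype_ker_map (Submodule.factor h₁)) (Submodule.factor_surjective h₁)
  have hzero : ∀ z : K ⊗[A] (LinearMap.ker (Submodule.factor h₁)), z = 0 := by
    intro z
    induction z using TensorProduct.induction_on with
    | zero => rfl
    | tmul q t =>
      have hq : q = c • (q * hc.unit⁻¹.1) := by
        rw [Algebra.smul_def, mul_left_comm, IsUnit.mul_val_inv, mul_one]
      have hct : c • t = 0 := Subtype.ext (smul_eq_zero_of_mem_ker_factor h₁ c h₂ t.1 t.2)
      rw [hq, TensorProduct.smul_tmul, hct, TensorProduct.tmul_zero]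
    | add x y hx hy => rw [hx, hy, add_zero]
  have hinj : Injective ((Submodule.factor h₁).lTensor K) := by
    rw [← LinearMap.ker_eq_bot, LinearMap.exact_iff.mp hexact, LinearMap.range_eq_bot]
    exact LinearMap.ext fun z ↦ by rw [hzero z, map_zero, LinearMap.zero_apply]
  have hbij : Bijective ((Submodule.factor h₁).baseChange K) := by
    rw [Function.Bijective, LinearMap.baseChange_eq_ltensor]
    exact ⟨hinj, LinearMap.lTensor_surjective K (Submodule.factor_surjective h₁)⟩
  exact Module.Finite.equiv (LinearEquiv.ofBijective _ hbij).symm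

/-- **M3 (membership ⇒ the `hm` socket).** If `c•M ⊆ N` with `c` a unit in `K` — e.g. `M = (𝒸 z)`, `N = (D·ι Lm)` and the MEMBERSHIP
reciprocity clause `(C c)·𝒸 z ∈ (D·ι Lm)` — then `λ(P ⧸ N) ≤ λ(P ⧸ M)`: no unit, no equality, no decoration is needed on the input side.
[cite: Kato2004Asterisque, Thm. 12.5 (1) (p. 221)] [cite: Washington1997, §13.2] -/
theorem finrank_baseChange_quotient_le_of_smul_mem (c : A) (hc : IsUnit (algebraMap A K c))
    {M N : Submodule A P} (hmem : ∀ m ∈ M, c • m ∈ N) [Module.Finite K (K ⊗[A] (P ⧸ M))] :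
    Module.finrank K (K ⊗[A] (P ⧸ N)) ≤ Module.finrank K (K ⊗[A] (P ⧸ M)) := by
  have hMN : ∀ m ∈ M, c • m ∈ M ⊓ N := fun m hm ↦ Submodule.mem_inf.mpr ⟨M.smul_mem c hm, hmem m hm⟩
  haveI : Module.Finite K (K ⊗[A] (P ⧸ (M ⊓ N))) := finite_baseChange_quotient_of_smul_le K c hc inf_le_left hMN
  calc Module.finrank K (K ⊗[A] (P ⧸ N)) ≤ Module.finrank K (K ⊗[A] (P ⧸ (M ⊓ N))) :=
        finrank_baseChange_quotient_anti K inf_le_right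
    _ = Module.finrank K (K ⊗[A] (P ⧸ M)) := finrank_baseChange_quotient_eq_of_smul_le K c hc inf_le_left hMN

/-- **M4 (saturation transfer of the flank).** `Z ≤ Zsat`, `c•Zsat ⊆ Z` ⇒ `λ(P/Z) = λ(P/Zsat)` (Kato's `Z` versus its `ϖ`-saturation or versus
`Λ·z` for a generator of `Z ⊗ ℚ`: clause (ii) may be cited for whichever print states). [cite: Kato2004Asterisque, Thm. 12.4–12.6 (pp. 221–222)] -/
theorem finrank_baseChange_quotient_eq_of_saturation (c : A) (hc : IsUnit (algebraMap A K c))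
    {Z Zsat : Submodule A P} (h₁ : Z ≤ Zsat) (h₂ : ∀ y ∈ Zsat, c • y ∈ Z) :
    Module.finrank K (K ⊗[A] (P ⧸ Z)) = Module.finrank K (K ⊗[A] (P ⧸ Zsat)) :=
  finrank_baseChange_quotient_eq_of_smul_le K c hc h₁ h₂

end MembershipKernel

section Principal

variable {A : Type u} [CommRing A] [IsDomain A] [IsDiscreteValuationRing A] [IsAdicComplete (IsLocalRing.maximalIdeal A) A]
  (K : Type w) [Field K] [Algebra A K] [IsFractionRing A K]

/-- **M3 for principal ideals of `Λ = A⟦X⟧`** (the shape of the HOLD's membership clause): for `w, F ∈ Λ` with `w ≠ 0` and `c ∈ A ∖ 0` with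
`(C c)·w ∈ (F)`: `λ(Λ/(F)) ≤ λ(Λ/(w))` (`(𝒸 z, D·ι Lm)` in the application; with `finrank_baseChange_quotient_span_mul_eq_add` this is
`d + λ(Λ/(D)) ≤ λ(Λ/(𝒸 z))`). [cite: Kato2004Asterisque, Thm. 12.5 (1) (p. 221)] [cite: Washington1997, §13.2] -/
theorem finrank_baseChange_quotient_span_le_of_C_smul_mem {c : A} (hc : c ≠ 0) {w F : PowerSeries A} (hw : w ≠ 0)
    (hmem : PowerSeries.C c * w ∈ Ideal.span {F}) :
    Module.finrank K (K ⊗[A] (PowerSeries A ⧸ Ideal.span {F})) ≤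
      Module.finrank K (K ⊗[A] (PowerSeries A ⧸ Ideal.span {w})) := by
  have htors : Module.IsTorsion (PowerSeries A) (PowerSeries A ⧸ Ideal.span {w}) := by
    intro x
    refine ⟨⟨w, mem_nonZeroDivisors_of_ne_zero hw⟩, ?_⟩
    obtain ⟨y, rfl⟩ := Submodule.Quotient.mk_surjective (Ideal.span {w}) x
    rw [Submonoid.mk_smul, ← Submodule.Quotient.mk_smul, Submodule.Quotient.mk_eq_zero, smul_eq_mul, mul_comm]
    exact Ideal.mem_span_singleton'.mpr ⟨y, rfl⟩
  have hfin : Module.Finite K (K ⊗[A] (PowerSeries A ⧸ Ideal.span {w})) :=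
    finite_baseChange_of_isTorsion K (PowerSeries A ⧸ Ideal.span {w}) htors
  -- the ideals as `A`-submodules (M3 is stated for `A`-submodules; `…DualityGlue` bridges the two quotients)
  haveI : Module.Finite K (K ⊗[A] (PowerSeries A ⧸ (Ideal.span {w}).restrictScalars A)) :=
    (finite_baseChange_quotient_restrictScalars_iff K (Ideal.span {w})).mpr hfin
  rw [← finrank_baseChange_quotient_restrictScalars_eq K (Ideal.span {F}),
    ← finrank_baseChange_quotient_restrictScalars_eq K (Ideal.span {w})]
  refine finrank_baseChange_quotient_le_of_smul_mem K c (isUnit_algebraMap_of_ne_zero K hc) fun m hm ↦ ?_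
  rw [Submodule.restrictScalars_mem] at hm ⊢
  obtain ⟨a, rfl⟩ := Ideal.mem_span_singleton'.mp hm
  rw [PowerSeries.smul_eq_C_mul, ← mul_assoc, mul_comm (PowerSeries.C c) a, mul_assoc]
  exact Ideal.mul_mem_left _ a hmem

/-- **`hm` from the MEMBERSHIP clause with decoration**: `(C c)·w ∈ (D·Lm)`, `w, D, Lm ≠ 0`, `c ≠ 0`, `d ≤ λ(Λ/(Lm))` ⇒
`d + λ(Λ/(D)) ≤ λ(Λ/(w))` (STUB-PLAN rev 7 §3.1′(b); `w = 𝒸 z`). [cite: Kato2004Asterisque, Thm. 12.5 (1) (p. 221)] [cite: Washington1997, §13.2] -/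
theorem add_le_finrank_baseChange_quotient_span_of_C_smul_mem {c : A} (hc : c ≠ 0) {w D Lm : PowerSeries A} (hw : w ≠ 0)
    (hD : D ≠ 0) (hLm : Lm ≠ 0) (hmem : PowerSeries.C c * w ∈ Ideal.span {D * Lm}) {d : ℕ}
    (hd : d ≤ Module.finrank K (K ⊗[A] (PowerSeries A ⧸ Ideal.span {Lm}))) :
    d + Module.finrank K (K ⊗[A] (PowerSeries A ⧸ Ideal.span {D})) ≤
      Module.finrank K (K ⊗[A] (PowerSeries A ⧸ Ideal.span {w})) := by
  have h := finrank_baseChange_quotient_span_le_of_C_smul_mem K hc hw hmem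
  rw [finrank_baseChange_quotient_span_mul_eq_add K hD hLm] at h
  omega

end Principal

/-! ## §2 The consumers with the membership socket -/

section Consumer

-- adapted from Cruxes/ResidualThetaCountLowerPureAtTwo/Sketch_sidea_k1_g5.lean §2 (stub-ideation k1 g5), M5, one-sided

variable {A : Type u} [CommRing A] [IsDomain A] [IsDiscreteValuationRing A] [IsAdicComplete (IsLocalRing.maximalIdeal A) A]
  (K : Type w) [Field K] [Algebra A K] [IsFractionRing A K]
  {H1Z Q X X0 P' : Type v}
  [AddCommGroup H1Z] [Module A H1Z]
  [AddCommGroup Q] [Module (PowerSeries A) Q] [Module A Q] [IsScalarTower A (PowerSeries A) Q] [Module.Finite (PowerSeries A) Q]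
  [AddCommGroup X] [Module (PowerSeries A) X] [Module A X] [IsScalarTower A (PowerSeries A) X] [Module.Finite (PowerSeries A) X]
  [AddCommGroup X0] [Module A X0]
  [AddCommGroup P'] [Module A P']

/-- **One-sided four-term assembly with `hm` fed by a MEMBERSHIP clause** (M5, one-sided): `Q ≅ P' ⧸ M` (`P' = Λ`, `M = (𝒸 z)`),
`c•M ⊆ N` (`N = (D·ι Lm)`), `m ≤ λ(P' ⧸ N)`, the flank and the 2½ exactness conditions ⇒ `m ≤ λ(X)`.
[cite: Kobayashi2003, Thm. 7.3 ((7.21), p. 13)] [cite: Kato2004Asterisque, Thm. 12.5 (1) (p. 221)] -/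
theorem le_finrank_baseChange_of_fourTerm_oneSided_of_smul_mem [Module.Finite K (K ⊗[A] H1Z)]
    (hQ : Module.IsTorsion (PowerSeries A) Q) (hX : Module.IsTorsion (PowerSeries A) X)
    (f : H1Z →ₗ[A] Q) (g : Q →ₗ[A] X) (h : X →ₗ[A] X0) (hker : LinearMap.ker g ≤ LinearMap.range f)
    (hcomp : LinearMap.range g ≤ LinearMap.ker h) (hh : Surjective h)
    {M N : Submodule A P'} (e : Q ≃ₗ[A] (P' ⧸ M)) {c : A} (hc : c ≠ 0) (hmem : ∀ m ∈ M, c • m ∈ N)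
    {m : ℕ} (hm : m ≤ Module.finrank K (K ⊗[A] (P' ⧸ N)))
    (hflank : Module.finrank K (K ⊗[A] H1Z) ≤ Module.finrank K (K ⊗[A] X0)) :
    m ≤ Module.finrank K (K ⊗[A] X) := by
  haveI : Module.Finite K (K ⊗[A] Q) := finite_baseChange_of_isTorsion K Q hQ
  haveI : Module.Finite K (K ⊗[A] (P' ⧸ M)) := Module.Finite.equiv (e.baseChange A K _ _)
  refine le_finrank_baseChange_of_fourTerm_oneSided K hQ hX f g h hker hcomp hh (hm.trans ?_) hflank
  rw [(e.baseChange A K _ _).finrank_eq]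
  exact finrank_baseChange_quotient_le_of_smul_mem K c (isUnit_algebraMap_of_ne_zero K hc) hmem

end Consumer

section DualityConsumer

variable {A : Type u} [CommRing A] (K : Type w) [Field K] [Algebra A K] [IsFractionRing A K]
  {Sel : Type v} [AddCommGroup Sel] [Module A Sel]
  {P : Type v} [AddCommGroup P] [Module A P]
  {H : Type v} [AddCommGroup H] [Module A H]
  {P' : Type v} [AddCommGroup P'] [Module A P']
  (pair : P →ₗ[A] CharacterModule Sel) (locd : H →ₗ[A] P) (Z : Submodule A H) (Sel₀ : Submodule A Sel)

/-- **The N5 duality bound with `hm` fed by a MEMBERSHIP clause**: as `le_finrank_baseChange_characterModule_of_duality` (p664041), with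
`P ⧸ locd(Z) ≅ P' ⧸ M` (`P' = Λ_𝒪` along the Coleman iso, `M = (𝒸 z)`; `…DualityGlue`), `c•M ⊆ N` (`N = (D·ι Lm)`: the HOLD's membership clause)
and `m ≤ λ(P' ⧸ N)` in place of `hm`. [cite: Kobayashi2003, Thm. 7.3 ((7.21), p. 13)] [cite: Kato2004Asterisque, Thm. 12.5 (1) (p. 221)] -/
theorem le_finrank_baseChange_characterModule_of_duality_of_smul_mem
    (hEH : ∀ z ∈ Z, pair (locd z) = 0) (horth : ∀ s ∈ Sel₀, ∀ z : P, pair z s = 0)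
    (hDH : ∀ z : P, pair z = 0 → ∃ a : A, a ≠ 0 ∧ ∃ x : H, a • z = locd x)
    [Module.Finite K (K ⊗[A] (H ⧸ Z))] [Module.Finite K (K ⊗[A] (P ⧸ Z.map locd))]
    [Module.Finite K (K ⊗[A] CharacterModule Sel)]
    {M N : Submodule A P'} (e : (P ⧸ Z.map locd) ≃ₗ[A] (P' ⧸ M)) {c : A} (hc : c ≠ 0) (hmem : ∀ m ∈ M, c • m ∈ N)
    {m : ℕ} (hm : m ≤ Module.finrank K (K ⊗[A] (P' ⧸ N)))
    (hflank : Module.finrank K (K ⊗[A] (H ⧸ Z)) ≤ Module.finrank K (K ⊗[A] CharacterModule Sel₀)) :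
    m ≤ Module.finrank K (K ⊗[A] CharacterModule Sel) := by
  haveI : Module.Finite K (K ⊗[A] (P' ⧸ M)) := Module.Finite.equiv (e.baseChange A K _ _)
  have hcK : IsUnit (algebraMap A K c) :=
    isUnit_iff_ne_zero.mpr ((map_ne_zero_iff (algebraMap A K) (IsFractionRing.injective A K)).mpr hc)
  refine le_finrank_baseChange_characterModule_of_duality K pair locd Z Sel₀ hEH horth hDH (hm.trans ?_) hflank
  rw [(e.baseChange A K _ _).finrank_eq]
  exact finrank_baseChange_quotient_le_of_smul_mem K c hcK hmem

end DualityConsumer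

end Summit.BirchSwinnertonDyer.BirchSwinnertonDyer.Theorems.CharIdealLambda

end
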